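import Literature.NumberTheory.EllipticCurves.MazurTateElementCoeffField
import Literature.NumberTheory.EllipticCurves.Sprung2017.SharpFlatPAdicLFunctionTwoProofs
import HarnessLib

/-!
# Sprung's ♯/♭ pairs and Pollack's ± pairs of a weight-`2` newform over `𝒪 = 𝒪_{ℚ_p(ι K_g)}`
# (Mazur–Tate characterisation, coefficients in the Hecke field along a `p`-adic embedding)

F. Sprung, *On pairs of `p`-adic `L`-functions for weight-two modular forms*, Algebra Number Theory
11 (2017) 885–928 [Sprung2017], Thm. 1.1 / Thm. 1.12: for a weight-two eigenform `f = ∑ aₙqⁿ` "which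
we assume to have good reduction at a fixed prime `p`", with `Λ = 𝒪⟦T⟧` for `𝒪` the ring of
integers of the (`p`-adically completed) coefficient field, there are `L_p^♯(f,T), L_p^♭(f,T)` with
`(L_p(f,α,T), L_p(f,β,T)) = (L_p^♯, L_p^♭)·𝓛og_{α,β}(1+T)`, constructed through the Mazur–Tate
elements (Cor. 4.4–4.5); R. Pollack, Duke Math. J. 118 (2003) [Pollack2003], Thm. 5.1 / Prop. 6.18
(the case `a_p = 0`: `L_p^±`). The tree vendors both characterisations for newforms WITH RATIONAL
COEFFICIENTS over `Λ = ℤ_p⟦T⟧` (`Sprung2017.IsSprungPair f p ap L♯ L♭`,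
`pollack_exists_plusMinusPAdicLFunction` / `Summit.….IsPollackPair f p L⁺ L⁻`), through
`mazurTateElement f p n ∈ ℚ[T]`, and PROVES the existence of a Sprung pair at `p = 2`
(`Sprung2017.exists_isSprungPair_two`).

This file is the COEFFICIENT-FIELD version of that vocabulary (cell `bsd-f1-sign2`, typer; TP2
F1-brief ask (3)(i): "`IsPollackPair`/`kobayashiL` over `𝓞_λ⟦T⟧`"), for a newform `g ∈ S₂(Γ₀(N))`
with Hecke field `K_g`, a period `Ω` and an embedding `ι : K_g → ℚ̄_p` (= a prime `λ ∣ p` of `K_g`),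
on top of `MazurTateElementCoeffField.lean` (`mazurTateElementK g Ω p n ∈ K_g[T]`) and the tree's
`𝒪 = padicCoeffIntegers S ⊆ ℚ̄_p` (`NewformPadicIntegralModel.lean`, `S = Set.range ι`): DEFINITIONS
with bodies and proved API; NOTHING is asserted (no named fact — in particular Sprung's existence
theorem over `𝒪` and Pollack's Thm. 5.1 for non-rational `g` are NOT vendored here).

* `IwasawaAlgebraO S = 𝒪⟦T⟧` (`PowerSeries (padicCoeffIntegers S)`; the one-variable sibling of the
  tree's `IwasawaAlgebraO₂`), `iwasawaOToPowerSeries S : 𝒪⟦T⟧ →+* ℚ̄_p⟦T⟧` (coefficientwise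
  inclusion; injective), `padicIntToCoeffIntegers S : ℤ_p →+* 𝒪` and
  `iwasawaToIwasawaO S : Λ = ℤ_p⟦T⟧ →+* 𝒪⟦T⟧`.
* `IsCongrModOmegaO S n θ L` — "`θ ≡ L (mod ω_n)` in `𝒪⟦T⟧ ⊗ ℚ`" for `θ ∈ ℚ̄_p[T]`,
  `L ∈ ℚ̄_p⟦T⟧`: `p^m (θ − L) = ω_n · q` for some `m ≥ 0`, `q ∈ 𝒪⟦T⟧` — the shape of the tree's
  `IsCongrModOmega p n θ ω L` (there `L ∈ ℤ_p⟦T⟧` with a polynomial multiplier `ω`; here the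
  multiplier is absorbed into `L`).
* `sprungSeqR`, `sharpPolyR ap p n = u_n`, `flatPolyR ap p n = v_n` — Sprung's recursion
  `x_n = a_p x_{n−1} − Φ_{p^{n−1}}(1+T) x_{n−2}` (first column of `𝒞_1⋯𝒞_n Ã⁻¹`, Cor. 4.4) with
  `a_p` in an arbitrary commutative ring `R` (the tree's `Sprung2017.sharpPoly/flatPoly` take
  `ap : ℤ`; `map_sharpPoly`, `map_flatPoly` identify them).
* `embCoeff g ι n = ι(aₙ(g)) ∈ ℚ̄_p`.
* `IsSprungPairK g Ω ι L♯ L♭` (`L♯, L♭ ∈ 𝒪⟦T⟧`, `𝒪 = padicCoeffIntegers (range ι)`): for every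
  `n`, `θ_n(g)^ι ≡ −(u_n L♯ + v_n L♭) (mod ω_n)` with `θ_n(g)^ι = (mazurTateElementK g Ω p n).map ι`
  and `u_n, v_n` computed with `a_p = ι(a_p(g))` — VERBATIM `Sprung2017.IsSprungPair` with
  `(ℚ, ℤ_p, a_p ∈ ℤ)` replaced by `(K_g →ι ℚ̄_p, 𝒪, ι(a_p(g)))`.
* `IsPollackPairK g Ω ι L⁺ L⁻`: both `≠ 0` and `θ_n(g)^ι ≡ (−1)^{⌊n/2⌋+1} ω_n^± L^± (mod ω_n)`
  (`n` odd: `+`; `n` even: `−`) — VERBATIM `Summit.….IsPollackPair` over `𝒪` (Pollack's labelling);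
  `kobayashiLK ε L⁺ L⁻` (Kobayashi's labelling, as `kobayashiL`).
* PROVED (non-vacuity; the rational case IS the tree's): `IsSprungPair.isSprungPairK` — for a
  rational newform `f` (`IsNewform0 f`, `coeffField f = ⊥`, `a_p(f) = ap`), ANY embedding
  `ι : K_f → ℚ̄_p` and `Ω = Ω⁺_f`, a Sprung pair `(L♯, L♭) ∈ Λ²` in the tree's sense gives the Sprung
  pair `(ι_Λ L♯, ι_Λ L♭) ∈ 𝒪⟦T⟧²` in the sense of this file; with `Sprung2017.exists_isSprungPair_two`
  this inhabits `IsSprungPairK` at `p = 2` for the newform of every elliptic curve with good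
  supersingular reduction at `2`. Likewise `IsPollackPair`-shaped data transfer
  (`isPollackPairK_of_congr`).

Conventions (as in the two tree files): cyclotomic variable `1 + T ↔ γ = cyclotomicGenerator p`,
level `p^{n+e₀}` (`2^{n+2}` at `p = 2`), trivial tame branch only, the overall sign `−1` of
`IsSprungPair`. Periods: the tree's rational objects are `Ω⁺_f`-normalised; for `g` the period `Ω` is
a PARAMETER, to be pinned by `IsCohomologicalPlusPeriod g ι Ω` (Pollack–Weston Def. 2.1) in
statements about `μ` (refuter trap T13 of cell `bsd-f1-sign2`).

## References

* F. Sprung, Algebra Number Theory 11 (2017): Thm. 1.1 (`Λ = 𝒪⟦T⟧`), Def. 1.7, Cor. 4.4, Cor. 4.5,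
  Thm. 1.12, §1.1 (`p = 2`: `N = n + 2`). [Sprung2017]
* R. Pollack, Duke Math. J. 118 (2003): Thm. 5.1, Prop. 6.18. [Pollack2003]
* S. Kobayashi, Invent. Math. 152 (2003), (3.6) p. 7 (labelling). [Kobayashi2003]
* R. Pollack, T. Weston, Duke Math. J. 156 (2011), §2.2, Def. 2.1. [PollackWeston2011MT]
-/

noncomputable section

open scoped MatrixGroups ModularForm

open CongruenceSubgroup Polynomial Literature.NumberTheory.EllipticCurves.ModularForms

namespace Literature.NumberTheory.EllipticCurves

/-! ### `𝒪⟦T⟧` and its embedding in `ℚ̄_p⟦T⟧` -/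

section IwasawaO

variable {p : ℕ} [Fact p.Prime] (S : Set (PadicAlgCl p))

/-- **`Λ_𝒪 = 𝒪⟦T⟧`** for `𝒪 = padicCoeffIntegers S`, the ring of integers of `ℚ_p(S) ⊆ ℚ̄_p`
(Sprung 2017, Thm. 1.1: "`Λ = 𝒪[[T]]`"; the one-variable sibling of the tree's `IwasawaAlgebraO₂`).
[cite: Sprung2017, Thm. 1.1 (`Λ = 𝒪[[T]]`)] -/
abbrev IwasawaAlgebraO : Type :=
  PowerSeries (padicCoeffIntegers S)

/-- The coefficientwise inclusion `𝒪⟦T⟧ → ℚ̄_p⟦T⟧` (the analogue of `iwasawaToPowerSeries :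
ℤ_p⟦T⟧ → ℚ_p⟦T⟧`). [cite: Sprung2017, Thm. 1.1 (`Λ = 𝒪[[T]]`; plumbing)] -/
def iwasawaOToPowerSeries : IwasawaAlgebraO S →+* PowerSeries (PadicAlgCl p) :=
  PowerSeries.map (padicCoeffIntegers S).subtype

/-- Coefficients of `iwasawaOToPowerSeries S L` are those of `L`. [cite: Sprung2017, Thm. 1.1 (`Λ = 𝒪[[T]]`; plumbing)] -/
@[simp] theorem coeff_iwasawaOToPowerSeries (L : IwasawaAlgebraO S) (k : ℕ) :
    PowerSeries.coeff k (iwasawaOToPowerSeries S L) = ((PowerSeries.coeff k L : padicCoeffIntegers S) :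
      PadicAlgCl p) := by
  simp [iwasawaOToPowerSeries]

/-- `𝒪⟦T⟧ → ℚ̄_p⟦T⟧` is injective. [cite: Sprung2017, Thm. 1.1 (`Λ = 𝒪[[T]]`; plumbing)] -/
theorem iwasawaOToPowerSeries_injective : Function.Injective (iwasawaOToPowerSeries S) :=
  PowerSeries.map_injective _ Subtype.coe_injective

/-- Coefficients of an element of `𝒪⟦T⟧` have norm `≤ 1` in `ℚ̄_p`. [cite: Sprung2017, Thm. 1.1 (`Λ = 𝒪[[T]]`; plumbing)] -/
theorem norm_coeff_iwasawaOToPowerSeries_le_one (L : IwasawaAlgebraO S) (k : ℕ) :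
    ‖PowerSeries.coeff k (iwasawaOToPowerSeries S L)‖ ≤ 1 := by
  rw [coeff_iwasawaOToPowerSeries]
  exact (PowerSeries.coeff k L).2.2

/-- `ℤ_p → 𝒪`: `ℤ_p ⊆ ℚ_p ⊆ ℚ_p(S)` and `‖x‖ ≤ 1` is preserved (`PadicAlgCl.norm_extends`). [cite: EmertonPollackWeston2006, §3.1 (p. 17) (`𝒪` the ring of integers of `K`; plumbing)] -/
def padicIntToCoeffIntegers : ℤ_[p] →+* padicCoeffIntegers S :=
  ((algebraMap ℚ_[p] (PadicAlgCl p)).comp (algebraMap ℤ_[p] ℚ_[p])).codRestrict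
    (padicCoeffIntegers S) fun x ↦ ⟨IntermediateField.algebraMap_mem _ _, by
      change ‖((x : ℚ_[p]) : PadicAlgCl p)‖ ≤ 1
      rw [PadicAlgCl.norm_extends, ← PadicInt.norm_def]
      exact x.norm_le_one⟩

/-- `padicIntToCoeffIntegers` read in `ℚ̄_p` is `ℤ_p ⊆ ℚ_p ⊆ ℚ̄_p`. [cite: EmertonPollackWeston2006, §3.1 (p. 17) (`𝒪` the ring of integers of `K`; plumbing)] -/
@[simp] theorem coe_padicIntToCoeffIntegers (x : ℤ_[p]) :
    ((padicIntToCoeffIntegers S x : padicCoeffIntegers S) : PadicAlgCl p) =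
      algebraMap ℚ_[p] (PadicAlgCl p) (x : ℚ_[p]) :=
  rfl

/-- `Λ = ℤ_p⟦T⟧ → 𝒪⟦T⟧`, coefficientwise. [cite: Sprung2017, Thm. 1.1 (`Λ = 𝒪[[T]]`; plumbing)] -/
def iwasawaToIwasawaO : IwasawaAlgebra p →+* IwasawaAlgebraO S :=
  PowerSeries.map (padicIntToCoeffIntegers S)

/-- Compatibility of the two inclusions: `𝒪⟦T⟧ → ℚ̄_p⟦T⟧` after `Λ → 𝒪⟦T⟧` is `ℚ_p⟦T⟧ → ℚ̄_p⟦T⟧`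
after `Λ → ℚ_p⟦T⟧`. [cite: Sprung2017, Thm. 1.1 (`Λ = 𝒪[[T]]`; plumbing)] -/
theorem iwasawaOToPowerSeries_iwasawaToIwasawaO (L : IwasawaAlgebra p) :
    iwasawaOToPowerSeries S (iwasawaToIwasawaO S L) =
      PowerSeries.map (algebraMap ℚ_[p] (PadicAlgCl p)) (iwasawaToPowerSeries p L) := by
  ext k
  simp [iwasawaToIwasawaO, iwasawaToPowerSeries]

/-- **`θ ≡ L (mod ω_n)` in `𝒪⟦T⟧ ⊗ ℚ`** for `θ ∈ ℚ̄_p[T]` and `L ∈ ℚ̄_p⟦T⟧`: there are `m ≥ 0` and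
`q ∈ 𝒪⟦T⟧` with `p^m·(θ − L) = ω_n·q` in `ℚ̄_p⟦T⟧` (`ω_n = cyclotomicOmega p n = (1+T)^{pⁿ} − 1`).
The shape of the tree's `IsCongrModOmega` (Pollack 2003 Prop. 6.18 / Sprung 2017 Cor. 4.4: congruences
in `Λ_n = Λ/ω_nΛ` up to a bounded denominator), over `𝒪` and with the multiplier absorbed into `L`.
[cite: Sprung2017, Cor. 4.4 and Cor. 4.5 (shape; `Λ = 𝒪[[T]]` of Thm. 1.1)] -/
def IsCongrModOmegaO (n : ℕ) (θ : (PadicAlgCl p)[X]) (L : PowerSeries (PadicAlgCl p)) : Prop :=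
  ∃ (m : ℕ) (q : IwasawaAlgebraO S),
    PowerSeries.C ((p : PadicAlgCl p) ^ m) * ((θ : PowerSeries (PadicAlgCl p)) - L) =
      (((cyclotomicOmega p n).map (Int.castRingHom (PadicAlgCl p)) : (PadicAlgCl p)[X]) :
          PowerSeries (PadicAlgCl p)) * iwasawaOToPowerSeries S q

/-- Unfolding lemma for `IsCongrModOmegaO`. [cite: Sprung2017, Cor. 4.4 (shape)] -/
theorem isCongrModOmegaO_iff (n : ℕ) (θ : (PadicAlgCl p)[X]) (L : PowerSeries (PadicAlgCl p)) :
    IsCongrModOmegaO S n θ L ↔ ∃ (m : ℕ) (q : IwasawaAlgebraO S),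
      PowerSeries.C ((p : PadicAlgCl p) ^ m) * ((θ : PowerSeries (PadicAlgCl p)) - L) =
        (((cyclotomicOmega p n).map (Int.castRingHom (PadicAlgCl p)) : (PadicAlgCl p)[X]) :
            PowerSeries (PadicAlgCl p)) * iwasawaOToPowerSeries S q :=
  Iff.rfl

variable {S}

/-- **Transfer `Λ → 𝒪⟦T⟧`**: a congruence `θ ≡ ω·L (mod ω_n)` in `Λ ⊗ ℚ_p` (`IsCongrModOmega`) gives,
after `ℚ_p⟦T⟧ → ℚ̄_p⟦T⟧`, the congruence `θ ≡ ω·L (mod ω_n)` in `𝒪⟦T⟧ ⊗ ℚ` for every `𝒪 ⊇ ℤ_p`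
(same exponent `m`, `q ↦ ι_Λ q`). [cite: Sprung2017, Cor. 4.4 (shape; base change `ℤ_p → 𝒪`)] -/
theorem IsCongrModOmega.isCongrModOmegaO {n : ℕ} {θ : ℚ[X]} {ω : ℤ[X]} {L : IwasawaAlgebra p}
    (h : IsCongrModOmega p n θ ω L) (S : Set (PadicAlgCl p)) :
    IsCongrModOmegaO S n (θ.map (algebraMap ℚ (PadicAlgCl p)))
      (((ω.map (Int.castRingHom (PadicAlgCl p)) : (PadicAlgCl p)[X]) : PowerSeries (PadicAlgCl p)) *
        iwasawaOToPowerSeries S (iwasawaToIwasawaO S L)) := by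
  obtain ⟨m, q, hmq⟩ := h
  refine ⟨m, iwasawaToIwasawaO S q, ?_⟩
  have key := congr_arg (PowerSeries.map (algebraMap ℚ_[p] (PadicAlgCl p))) hmq
  -- push the map through
  have hpoly : ∀ (P : ℤ[X]), PowerSeries.map (algebraMap ℚ_[p] (PadicAlgCl p))
      (iwasawaToPowerSeries p ((P.map (Int.castRingHom ℤ_[p]) : ℤ_[p][X]) : PowerSeries ℤ_[p])) =
      (((P.map (Int.castRingHom (PadicAlgCl p)) : (PadicAlgCl p)[X]) : PowerSeries (PadicAlgCl p))) := by
    intro P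
    ext k
    simp [iwasawaToPowerSeries, Polynomial.coeff_coe, PowerSeries.coeff_map]
  have hθ : PowerSeries.map (algebraMap ℚ_[p] (PadicAlgCl p))
      ((θ.map (algebraMap ℚ ℚ_[p]) : ℚ_[p][X]) : PowerSeries ℚ_[p]) =
      ((θ.map (algebraMap ℚ (PadicAlgCl p)) : (PadicAlgCl p)[X]) : PowerSeries (PadicAlgCl p)) := by
    ext k
    simp only [PowerSeries.coeff_map, Polynomial.coeff_coe, Polynomial.coeff_map]
    rw [← RingHom.comp_apply, RingHom.ext_rat ((algebraMap ℚ_[p] (PadicAlgCl p)).comp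
      (algebraMap ℚ ℚ_[p])) (algebraMap ℚ (PadicAlgCl p))]
  simp only [map_mul, map_sub, map_pow, map_natCast] at key
  rw [hθ, hpoly, hpoly, ← iwasawaOToPowerSeries_iwasawaToIwasawaO,
    ← iwasawaOToPowerSeries_iwasawaToIwasawaO] at key
  rw [map_pow, map_natCast]
  exact key

end IwasawaO

/-! ### Sprung's recursion with `a_p` in a ring -/

section SprungR

variable {R : Type*} [CommRing R] (ap : R) (p : ℕ)

/-- **Sprung's recursion over `R`**: `x_0, x_1` given, `x_{n+2} = a_p·x_{n+1} − Φ_{p^{n+1}}(1+T)·x_n`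
in `R[T]` (Sprung 2017, Def. 1.7 / Cor. 4.4: the first column of `𝒞_1⋯𝒞_n Ã⁻¹`,
`𝒞_i = (a_p, 1; −Φ_{p^i}(1+T), 0)`), for `a_p ∈ R` — the tree's `Sprung2017.sprungSeq` has `a_p ∈ ℤ`
(rational newforms); for a newform with Hecke field `K_g` read along `ι`, `a_p = ι(a_p(g)) ∈ ℚ̄_p`.
[cite: Sprung2017, Def. 1.7 and Cor. 4.4] -/
def sprungSeqR (x₀ x₁ : R[X]) : ℕ → R[X]
  | 0 => x₀
  | 1 => x₁
  | n + 2 => C ap * sprungSeqR x₀ x₁ (n + 1) - (cyclotomic (p ^ (n + 1)) R).comp (X + 1) * sprungSeqR x₀ x₁ n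

/-- `u_n ∈ R[T]`, the coefficient of `L♯` at level `n` (`u_0 = 0`, `u_1 = 1`).
[cite: Sprung2017, Cor. 4.4] -/
def sharpPolyR : ℕ → R[X] :=
  sprungSeqR ap p 0 1

/-- `v_n ∈ R[T]`, the coefficient of `L♭` at level `n` (`v_0 = 1`, `v_1 = 0`).
[cite: Sprung2017, Cor. 4.4] -/
def flatPolyR : ℕ → R[X] :=
  sprungSeqR ap p 1 0

variable (x₀ x₁ : R[X])

/-- `x_0`. [cite: Sprung2017, Cor. 4.4] -/
@[simp] theorem sprungSeqR_zero : sprungSeqR ap p x₀ x₁ 0 = x₀ := rfl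

/-- `x_1`. [cite: Sprung2017, Cor. 4.4] -/
@[simp] theorem sprungSeqR_one : sprungSeqR ap p x₀ x₁ 1 = x₁ := rfl

/-- `x_{n+2} = a_p x_{n+1} − Φ_{p^{n+1}}(1+T) x_n`. [cite: Sprung2017, Cor. 4.4] -/
theorem sprungSeqR_add_two (n : ℕ) :
    sprungSeqR ap p x₀ x₁ (n + 2) = C ap * sprungSeqR ap p x₀ x₁ (n + 1) -
      (cyclotomic (p ^ (n + 1)) R).comp (X + 1) * sprungSeqR ap p x₀ x₁ n := rfl

/-- **The `R`-recursion is the base change of the `ℤ`-recursion**: for `a ∈ ℤ`,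
`(Sprung2017.sprungSeq a p x₀ x₁ n).map (ℤ → R) = sprungSeqR (a : R) p (x₀.map _) (x₁.map _) n`
(the cyclotomic polynomials are defined over `ℤ`: `Polynomial.map_cyclotomic`). [cite: Sprung2017, Cor. 4.4] -/
theorem map_sprungSeq (a : ℤ) (y₀ y₁ : ℤ[X]) (n : ℕ) :
    (Sprung2017.sprungSeq a p y₀ y₁ n).map (Int.castRingHom R) =
      sprungSeqR (a : R) p (y₀.map (Int.castRingHom R)) (y₁.map (Int.castRingHom R)) n := by
  induction n using Nat.strong_induction_on with
  | _ n ih =>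
    match n, ih with
    | 0, _ => rfl
    | 1, _ => rfl
    | n + 2, ih =>
      rw [Sprung2017.sprungSeq_add_two, sprungSeqR_add_two, Polynomial.map_sub, Polynomial.map_mul,
        Polynomial.map_mul, Polynomial.map_C, eq_intCast, ih (n + 1) (by omega), ih n (by omega),
        Polynomial.map_comp, map_cyclotomic, Polynomial.map_add, Polynomial.map_X, Polynomial.map_one]

/-- `(Sprung2017.sharpPoly a p n).map (ℤ → R) = sharpPolyR (a : R) p n`. [cite: Sprung2017, Cor. 4.4] -/
theorem map_sharpPoly (a : ℤ) (n : ℕ) :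
    (Sprung2017.sharpPoly a p n).map (Int.castRingHom R) = sharpPolyR (a : R) p n := by
  rw [Sprung2017.sharpPoly, map_sprungSeq, Polynomial.map_zero, Polynomial.map_one]
  rfl

/-- `(Sprung2017.flatPoly a p n).map (ℤ → R) = flatPolyR (a : R) p n`. [cite: Sprung2017, Cor. 4.4] -/
theorem map_flatPoly (a : ℤ) (n : ℕ) :
    (Sprung2017.flatPoly a p n).map (Int.castRingHom R) = flatPolyR (a : R) p n := by
  rw [Sprung2017.flatPoly, map_sprungSeq, Polynomial.map_zero, Polynomial.map_one]
  rfl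

end SprungR

/-! ### Sprung and Pollack pairs over `𝒪` for a newform with Hecke field `K_g` -/

section PairK

variable {N : ℕ} (g : CuspForm (Gamma0 N) 2) {p : ℕ} [Fact p.Prime]
  (ι : coeffField g →+* PadicAlgCl p)

/-- `ι(aₙ(g)) ∈ ℚ̄_p`: the `n`-th Fourier coefficient of `g` (an element of `K_g = coeffField g`,
`coeff_mem_coeffField`) read along the embedding `ι` (as in the tree's `IsIntegralPadicModel`).
[cite: EmertonPollackWeston2006, §3.1 (p. 17) (`𝒪` the ring of integers of `K`; plumbing)] -/
def embCoeff (n : ℕ) : PadicAlgCl p :=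
  ι ⟨cuspCoeff g n, coeff_mem_coeffField g n⟩

/-- Unfolding lemma for `embCoeff`. [cite: EmertonPollackWeston2006, §3.1 (p. 17) (`𝒪` the ring of integers of `K`; plumbing)] -/
theorem embCoeff_def (n : ℕ) : embCoeff g ι n = ι ⟨cuspCoeff g n, coeff_mem_coeffField g n⟩ :=
  rfl

/-- If `aₙ(g)` is the integer `a` then `ι(aₙ(g)) = a`. [cite: EmertonPollackWeston2006, §3.1 (p. 17) (`𝒪` the ring of integers of `K`; plumbing)] -/
theorem embCoeff_eq_intCast {n : ℕ} {a : ℤ} (h : cuspCoeff g n = (a : ℂ)) : embCoeff g ι n = a := by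
  rw [embCoeff_def, ← map_intCast ι a]
  congr 1
  apply Subtype.ext
  change cuspCoeff g n = ((a : coeffField g) : ℂ)
  rw [h]
  simp

variable (Ω : ℂ)

/-- **`(L♯, L♭) ∈ 𝒪⟦T⟧²` is a Sprung pair for the newform `g` along `ι`, relative to the period `Ω`**
— Sprung 2017, Thm. 1.1/1.12 in the Mazur–Tate form of Cor. 4.4–4.5 ("`(Θ_n, νΘ_{n−1}) =
Υ_n 𝒞_1⋯𝒞_n Ã⁻¹` for some `Υ_n ∈ Λ_n^{⊕2}`", `Λ = 𝒪[[T]]`), read on the first column EXACTLY as the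
tree's `Sprung2017.IsSprungPair`: for every level `n ≥ 0`,
`θ_n(g)^ι ≡ −(u_n·L♯ + v_n·L♭) (mod ω_n)` in `𝒪⟦T⟧ ⊗ ℚ`, where
`θ_n(g)^ι = (mazurTateElementK g Ω p n).map ι ∈ ℚ̄_p[T]`, `u_n = sharpPolyR (ι a_p(g)) p n`,
`v_n = flatPolyR (ι a_p(g)) p n`, `𝒪 = padicCoeffIntegers (range ι)`. A predicate; nothing asserted
(Sprung's existence theorem over `𝒪` is not vendored here; for a rational newform the tree's pairs
ARE such pairs, `IsSprungPair.isSprungPairK`). [cite: Sprung2017, Thm. 1.1, Cor. 4.4, Cor. 4.5 and Thm. 1.12 (shape only; nothing asserted)] -/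
def IsSprungPairK (Lsharp Lflat : IwasawaAlgebraO (Set.range ι)) : Prop :=
  ∀ n : ℕ, IsCongrModOmegaO (Set.range ι) n ((mazurTateElementK g Ω p n).map ι)
    (-((((sharpPolyR (embCoeff g ι p) p n : (PadicAlgCl p)[X]) : PowerSeries (PadicAlgCl p)) *
          iwasawaOToPowerSeries (Set.range ι) Lsharp +
        ((flatPolyR (embCoeff g ι p) p n : (PadicAlgCl p)[X]) : PowerSeries (PadicAlgCl p)) *
          iwasawaOToPowerSeries (Set.range ι) Lflat)))

/-- Unfolding lemma for `IsSprungPairK`. [cite: Sprung2017, Cor. 4.4 (shape only; nothing asserted)] -/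
theorem isSprungPairK_iff (Lsharp Lflat : IwasawaAlgebraO (Set.range ι)) :
    IsSprungPairK g ι Ω Lsharp Lflat ↔
      ∀ n : ℕ, IsCongrModOmegaO (Set.range ι) n ((mazurTateElementK g Ω p n).map ι)
        (-((((sharpPolyR (embCoeff g ι p) p n : (PadicAlgCl p)[X]) : PowerSeries (PadicAlgCl p)) *
              iwasawaOToPowerSeries (Set.range ι) Lsharp +
            ((flatPolyR (embCoeff g ι p) p n : (PadicAlgCl p)[X]) : PowerSeries (PadicAlgCl p)) *
              iwasawaOToPowerSeries (Set.range ι) Lflat))) :=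
  Iff.rfl

/-- **`(L⁺, L⁻) ∈ 𝒪⟦T⟧²` is a Pollack pair for the newform `g` along `ι`, relative to `Ω`** (POLLACK's
labelling) — VERBATIM the tree's `Summit.BirchSwinnertonDyer.Rank1Residual.Supersingular.IsPollackPair`
(the body of `pollack_exists_plusMinusPAdicLFunction`, Pollack 2003 Thm. 5.6 / Cor. 5.11 / Prop. 6.18)
over `𝒪`: `L⁺ ≠ 0`, `L⁻ ≠ 0`, and `θ_n(g)^ι ≡ (−1)^{⌊n/2⌋+1} ω_n^+ L⁺ (mod ω_n)` for `n` odd,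
`θ_n(g)^ι ≡ (−1)^{⌊n/2⌋+1} ω_n^- L⁻ (mod ω_n)` for `n` even. Intended for `a_p(g) = 0`, where it is
`IsSprungPairK` plus non-vanishing (`u_{2k+1} = (−1)^k ω⁺_{2k+1}`, `v_{2k} = (−1)^k ω⁻_{2k}`). A
predicate; nothing asserted (Pollack's Thm. 5.1 for non-rational `g` is not vendored here).
[cite: Pollack2003, Thm. 5.6, Cor. 5.11 and Prop. 6.18 (shape only; nothing asserted)] -/
def IsPollackPairK (Lplus Lminus : IwasawaAlgebraO (Set.range ι)) : Prop :=
  Lplus ≠ 0 ∧ Lminus ≠ 0 ∧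
    (∀ n : ℕ, Odd n →
      IsCongrModOmegaO (Set.range ι) n ((mazurTateElementK g Ω p n).map ι)
        (((((-1) ^ (n / 2 + 1) * cyclotomicOmegaPlus p n).map (Int.castRingHom (PadicAlgCl p)) :
            (PadicAlgCl p)[X]) : PowerSeries (PadicAlgCl p)) *
          iwasawaOToPowerSeries (Set.range ι) Lplus)) ∧
    (∀ n : ℕ, Even n →
      IsCongrModOmegaO (Set.range ι) n ((mazurTateElementK g Ω p n).map ι)
        (((((-1) ^ (n / 2 + 1) * cyclotomicOmegaMinus p n).map (Int.castRingHom (PadicAlgCl p)) :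
            (PadicAlgCl p)[X]) : PowerSeries (PadicAlgCl p)) *
          iwasawaOToPowerSeries (Set.range ι) Lminus))

variable {g ι Ω}

/-- A Pollack pair over `𝒪` has `L⁺ ≠ 0` and `L⁻ ≠ 0`. [cite: Pollack2003, Cor. 5.11 (shape)] -/
theorem IsPollackPairK.ne_zero {Lplus Lminus : IwasawaAlgebraO (Set.range ι)}
    (h : IsPollackPairK g ι Ω Lplus Lminus) : Lplus ≠ 0 ∧ Lminus ≠ 0 :=
  ⟨h.1, h.2.1⟩

/-- **Kobayashi's labelling** of the signed function of sign `ε` picked out of a Pollack pair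
`(L⁺, L⁻)` in Pollack's labelling, over `𝒪⟦T⟧` — as the tree's `kobayashiL` (Kobayashi 2003 p. 7:
"our sign of Pollack's `p`-adic `L`-function is opposite to that in [18]"): `ε = 1 ↦ L⁻`, `ε = −1 ↦ L⁺`.
[cite: Kobayashi2003, Thm. 3.2 and (3.6) (p. 7)] -/
def kobayashiLK {S : Set (PadicAlgCl p)} (ε : ℤˣ) (Lplus Lminus : IwasawaAlgebraO S) :
    IwasawaAlgebraO S :=
  if ε = 1 then Lminus else Lplus

/-- `kobayashiLK 1 L⁺ L⁻ = L⁻`. [cite: Kobayashi2003, (3.6) (p. 7)] -/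
@[simp] theorem kobayashiLK_one {S : Set (PadicAlgCl p)} (Lplus Lminus : IwasawaAlgebraO S) :
    kobayashiLK 1 Lplus Lminus = Lminus := by
  simp [kobayashiLK]

/-- `kobayashiLK (−1) L⁺ L⁻ = L⁺`. [cite: Kobayashi2003, (3.6) (p. 7)] -/
@[simp] theorem kobayashiLK_neg_one {S : Set (PadicAlgCl p)} (Lplus Lminus : IwasawaAlgebraO S) :
    kobayashiLK (-1) Lplus Lminus = Lplus := by
  simp [kobayashiLK]

end PairK

/-! ### The rational case: the tree's pairs are pairs over `𝒪` (non-vacuity) -/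

section Rational

variable {N : ℕ} [NeZero N] {f : CuspForm (Gamma0 N) 2} {p : ℕ} [Fact p.Prime]
  (ι : coeffField f →+* PadicAlgCl p)

/-- For a rational newform, `θ_n(f)^ι` (relative to `Ω⁺_f`, along ANY `ι : K_f → ℚ̄_p`) is the tree's
`mazurTateElement f p n` read in `ℚ̄_p[T]`. [cite: Pollack2003, Def. 6.15] -/
theorem map_mazurTateElementK_plusPeriod (hf : IsNewform0 f) (hQ : coeffField f = ⊥) (n : ℕ) :
    (mazurTateElementK f (plusPeriod f : ℂ) p n).map ι =
      (mazurTateElement f p n).map (algebraMap ℚ (PadicAlgCl p)) := by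
  rw [mazurTateElementK_plusPeriod_eq hf hQ, Polynomial.map_map,
    RingHom.ext_rat (ι.comp (algebraMap ℚ (coeffField f))) (algebraMap ℚ (PadicAlgCl p))]

/-- **The tree's Sprung pairs are Sprung pairs over `𝒪`.** For a rational newform `f`
(`IsNewform0 f`, `coeffField f = ⊥`) with `a_p(f) = ap ∈ ℤ`, any embedding `ι : K_f → ℚ̄_p` and the
period `Ω⁺_f`: if `(L♯, L♭) ∈ Λ²` is a Sprung pair (`Sprung2017.IsSprungPair f p ap L♯ L♭`) then
`(ι_Λ L♯, ι_Λ L♭) ∈ 𝒪⟦T⟧²` is one in the sense of `IsSprungPairK` (map the congruences along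
`ℚ_p⟦T⟧ → ℚ̄_p⟦T⟧`, `IsCongrModOmega.isCongrModOmegaO`; `u_n, v_n` are base-changed by
`map_sharpPoly`/`map_flatPoly`, `ι(a_p(f)) = ap` by `embCoeff_eq_intCast`). With
`Sprung2017.exists_isSprungPair_two` this INHABITS `IsSprungPairK` at `p = 2` for the newform of an
elliptic curve with good supersingular reduction at `2`. [cite: Sprung2017, Thm. 1.12 and Cor. 4.4] -/
theorem Sprung2017.IsSprungPair.isSprungPairK (hf : IsNewform0 f) (hQ : coeffField f = ⊥) {ap : ℤ}
    (hap : cuspCoeff f p = (ap : ℂ)) {Lsharp Lflat : IwasawaAlgebra p}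
    (h : Sprung2017.IsSprungPair f p ap Lsharp Lflat) :
    IsSprungPairK f ι (plusPeriod f : ℂ) (iwasawaToIwasawaO (Set.range ι) Lsharp)
      (iwasawaToIwasawaO (Set.range ι) Lflat) := by
  intro n
  have h1 := (h n).isCongrModOmegaO (Set.range ι)
  rw [← map_mazurTateElementK_plusPeriod ι hf hQ] at h1
  have hu : (((sharpPolyR (embCoeff f ι p) p n : (PadicAlgCl p)[X]) : PowerSeries (PadicAlgCl p))) =
      PowerSeries.map (algebraMap ℚ_[p] (PadicAlgCl p))
        (iwasawaToPowerSeries p (Sprung2017.toIwasawa p (Sprung2017.sharpPoly ap p n))) := by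
    rw [embCoeff_eq_intCast f ι hap, ← map_sharpPoly]
    ext k
    simp [Sprung2017.toIwasawa, iwasawaToPowerSeries, Polynomial.coeff_coe, PowerSeries.coeff_map]
  have hv : (((flatPolyR (embCoeff f ι p) p n : (PadicAlgCl p)[X]) : PowerSeries (PadicAlgCl p))) =
      PowerSeries.map (algebraMap ℚ_[p] (PadicAlgCl p))
        (iwasawaToPowerSeries p (Sprung2017.toIwasawa p (Sprung2017.flatPoly ap p n))) := by
    rw [embCoeff_eq_intCast f ι hap, ← map_flatPoly]
    ext k
    simp [Sprung2017.toIwasawa, iwasawaToPowerSeries, Polynomial.coeff_coe, PowerSeries.coeff_map]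
  have hm1 : ((((-1 : ℤ[X])).map (Int.castRingHom (PadicAlgCl p)) : (PadicAlgCl p)[X]) :
      PowerSeries (PadicAlgCl p)) = -1 := by
    simp
  rw [hm1, iwasawaOToPowerSeries_iwasawaToIwasawaO] at h1
  simp only [map_add, map_mul] at h1
  rw [← hu, ← hv, ← iwasawaOToPowerSeries_iwasawaToIwasawaO, ← iwasawaOToPowerSeries_iwasawaToIwasawaO,
    neg_one_mul] at h1
  exact h1

/-- **`IsSprungPairK` is inhabited at `p = 2`** (no vacuity by lack of instances): for an elliptic
curve `E = W/ℚ` with good supersingular reduction at `2` (`2 ∣ a₂`, i.e. `a₂ ∈ {0, ±2}`), its newform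
`f` (`IsNewformOf W f`) and ANY embedding `ι : K_f → ℚ̄_2`, there is a Sprung pair over
`𝒪 = padicCoeffIntegers (range ι)` relative to `Ω⁺_f` — the tree's THEOREM
`Sprung2017.exists_isSprungPair_two` (Sprung 2017 §1.1, `N = n + 2`) transported by
`IsSprungPair.isSprungPairK`. [cite: Sprung2017, §1.1, Thm. 1.12, Cor. 4.4 and Cor. 4.5] -/
theorem exists_isSprungPairK_two {W : WeierstrassCurve ℚ} [W.IsElliptic] [W.IsGloballyMinimal]
    {N : ℕ} [NeZero N] {f : CuspForm (Gamma0 N) 2} (hf : IsNewformOf W f)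
    (hgood : W.HasGoodReductionAtPrime 2) (hap : (2 : ℤ) ∣ W.frobeniusTrace 2)
    (ι : coeffField f →+* PadicAlgCl 2) :
    ∃ Lsharp Lflat : IwasawaAlgebraO (Set.range ι), IsSprungPairK f ι (plusPeriod f : ℂ) Lsharp Lflat := by
  obtain ⟨Ls, Lf, h⟩ := Sprung2017.exists_isSprungPair_two hf hgood hap
  exact ⟨_, _, h.isSprungPairK ι hf.1 hf.coeffField_eq_bot
    (cuspCoeff_eq_frobeniusTrace_of_isNewformOf_holds hf hgood)⟩

end Rational

end Literature.NumberTheory.EllipticCurves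

end
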